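import Summits.AtomisticToContinuum.HydrodynamicLimit.Theorems.CollisionIsometryCLTAdaptedWeightCLTBHDVTransferGlue

/-!
# DV transfer for the line `block-h-dissipation-closure` (crux `AdaptedWeightCLT`, stmt-AtomisticToContinuum-14868),
# file 7: the typed inputs of the transfer and the corrected form of `stub_dvTransfer`

Definitions-and-statements support file (`--supports stmt-AtomisticToContinuum-14868`, anchor
`bhDVTransfer_inputs_anchor`) of the line lead `prover-line-stmt-AtomisticToContinuum-14868-c4-0`, written by the
S2 worker. The registered stub `stub_dvTransfer` (`EntropyChaosRelOn ⇒ OneSidedOn` from `TailsOn` +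
`FewCollisionsOn` alone, for `δ < δ₀`, `h < h₀`) is MIS-STATED: (1) its per-contact commutators (observable ↔
measure with the window-start law; the KDE / co-moving-floor commutator of the chaotic exponential moment; the
window-start ↔ contact-time chaotic dissipation) are small only at non-lonely contact velocities in non-hyperactive
cell-windows, which `TailsOn` + `FewCollisionsOn` do not control; (2) the floor commutator is `O(δ)` RELATIVE to
the Hellinger dissipation and would have to be absorbed into the residue constant `c₀` of `EntropyChaosRelOn`, which
is existentially hidden and may depend on `(h, δ)` — so no `δ₀` chosen before `c₀` can absorb it. This file types
the inputs the Donsker–Varadhan route actually consumes, over the line's vocabulary: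

* objects: `dLam` (the log-increment `ΔΛ(y) = Λ y₃ + Λ y₄ − Λ y₁ − Λ y₂`, `Λ = log cellLaw` of the WINDOW-START
  configuration), `cellOK` (indicator of the non-junk cell-windows `pairZ > 0`), `dvAct` (one half of the DV action
  `−½ ∫ ΔΛ · contactDens` of a cell-window), `crossE` (contact mass times the smeared cross-Hellinger defect
  `1 − ∫ e^{ΔΛ/2} chaosDens`), and their aggregates `dvActW`, `crossEW` over `k < nWin`, `x ∈ 𝕋³` (non-junk only);
* statements (`…On … t`, all `localGibbsLaw`-probabilities, absolute slack `η (N+1)^{1/3}`, ONE-SIDED):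
  `IncrToMeasureOn` (G1: `realDiss ≥ (1−δ) dvActW`), `DVAggregateOn` (G2: `dvActW ≥ crossEW − relEnt`; provable
  bookkeeping: `dv_step` of file 5 integrated in `x` and summed in `k`, needs only `x`-integrability on good orbits),
  `CrossHellingerOn` (G3: `crossEW ≥ chaosDissW`), `ChaosTimeOn` (G4: `chaosDiss ≤ K₀ chaosDissW`, `∃ K₀ > 0`);
* `DVTransferStub'` — the CORRECTED statement of S2 (same prefix as the registered one, then for all
  `(h, δ) ∈ (0,1)²`: `G1 → G2 → G3 → G4 → EntropyChaosRelOn → OneSidedOn`), and its proof `dvTransferStub'_holds`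
  from `oneSidedOn_of_dvChain` (file 6).

Nothing is asserted: every `def … : Prop` is a predicate. G1, G3, G4 are the open per-contact inputs (the lead
decides whether to stub them as they are or to derive them from a lonely/hyperactive contact census); G2 is closed
bookkeeping up to `x`-integrability.
-/

namespace Summit.AtomisticToContinuum.HydrodynamicLimit.Theorems.BlockHDissipation

open scoped BigOperators Topology Classical MeasureTheory ENNReal InnerProductSpace
open Filter Set MeasureTheory
open Literature.Analysis.FluidPDE
open Summit.AtomisticToContinuum.HydrodynamicLimit.Theorems.ContactSourceDuhamel (T3 V3 Cfg Vel Flow Flows)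
open Summit.AtomisticToContinuum.HydrodynamicLimit.Theorems.ContactSourceDuhamel.TimeLocal
open Literature.MathematicalPhysics.KineticTheory (hsDiameter localGibbsLaw collide hardSphereKernel
  sphereMeasure)

noncomputable section

/-! ## Objects of the DV chain -/

/-- The LOG-INCREMENT of a contact quadruple `y = (v_a⁻, v_b⁻, v_a⁺, v_b⁺)` for the regularised cell law of the
configuration `w` at `x`: `ΔΛ(y) = Λ(v_a⁺) + Λ(v_b⁺) − Λ(v_a⁻) − Λ(v_b⁻)`, `Λ = log f̂_{w,x}`. -/
def dLam (N : ℕ) (ψ : ℕ → T3 → ℝ) (h δ : ℝ) (w : Cfg N) (x : T3) (y : Quad) : ℝ :=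
  Real.log (cellLaw N ψ h δ w x y.2.2.1) + Real.log (cellLaw N ψ h δ w x y.2.2.2) -
    Real.log (cellLaw N ψ h δ w x y.1) - Real.log (cellLaw N ψ h δ w x y.2.1)

/-- Indicator of the NON-JUNK cell-windows: `1` if the atomic cell law of the window-start configuration
`Φ_{kΔ} z` has positive pair flux at `x` (two atoms of positive weight with distinct velocities), else `0`
(then `chaosDens ≡ 0` and `klTerm = 0` by the junk conventions, `klTerm_eq_zero_of_pairZ_eq_zero`). -/
def cellOK (σ : ℝ) (N : ℕ) (Φ : Flow σ N) (ψ : ℕ → T3 → ℝ) (γc : ℝ) (z : Cfg N) (k : ℕ) (x : T3) : ℝ :=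
  if 0 < pairZ N ψ (Φ.flow ((k : ℝ) * winW γc N) z) x then 1 else 0

/-- One half of the DONSKER–VARADHAN ACTION of the realised contacts of window `k` at `x`:
`−∫ (ΔΛ/2) · contactDens dy`, `ΔΛ` of the window-start cell law. -/
def dvAct (σ : ℝ) (N : ℕ) (Φ : Flow σ N) (ψ : ℕ → T3 → ℝ) (γc h δ t : ℝ) (z : Cfg N) (k : ℕ) (x : T3) : ℝ :=
  -∫ y : Quad, 2⁻¹ * dLam N ψ h δ (Φ.flow ((k : ℝ) * winW γc N) z) x y * contactDens σ N Φ ψ γc h t z k x y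

/-- The CROSS-HELLINGER MASS of window `k` at `x`: the contact mass times the smeared cross-Hellinger defect
`1 − ∫ e^{ΔΛ/2} chaosDens dy` of the chaos reference (for pairs drawn from `f̂ ⊗ f̂ B / Z(f̂)` instead of the smeared
atomic pairs this defect is EXACTLY `hellDiss f̂`, `DVTransfer.integral_fluxPair_exp_half_eq`). -/
def crossE (σ : ℝ) (N : ℕ) (Φ : Flow σ N) (ψ : ℕ → T3 → ℝ) (γc h δ t : ℝ) (z : Cfg N) (k : ℕ) (x : T3) : ℝ :=
  contactMass σ N Φ ψ γc t z k x *
    (1 - ∫ y : Quad, Real.exp (2⁻¹ * dLam N ψ h δ (Φ.flow ((k : ℝ) * winW γc N) z) x y) *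
      chaosDens N ψ h (Φ.flow ((k : ℝ) * winW γc N) z) x y)

/-- Aggregate DV action over the non-junk cell-windows: `(N+1)⁻¹ Σ_{k < nWin} ∫ₓ cellOK · dvAct`. -/
def dvActW (σ : ℝ) (N : ℕ) (Φ : Flow σ N) (ψ : ℕ → T3 → ℝ) (γc h δ t : ℝ) (z : Cfg N) : ℝ :=
  ((N + 1 : ℕ) : ℝ)⁻¹ * ∑ k ∈ Finset.range (nWin γc N t),
    ∫ x, cellOK σ N Φ ψ γc z k x * dvAct σ N Φ ψ γc h δ t z k x

/-- Aggregate cross-Hellinger mass over the non-junk cell-windows: `(N+1)⁻¹ Σ_{k < nWin} ∫ₓ cellOK · crossE`. -/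
def crossEW (σ : ℝ) (N : ℕ) (Φ : Flow σ N) (ψ : ℕ → T3 → ℝ) (γc h δ t : ℝ) (z : Cfg N) : ℝ :=
  ((N + 1 : ℕ) : ℝ)⁻¹ * ∑ k ∈ Finset.range (nWin γc N t),
    ∫ x, cellOK σ N Φ ψ γc z k x * crossE σ N Φ ψ γc h δ t z k x

/-! ## The four inputs of the DV chain on the horizon `[0, t]` -/

/-- (G1) INCREMENTS-TO-MEASURE, one-sided: `∀ η > 0`, `P_N{realDiss + η (N+1)^{1/3} < (1 − δ) dvActW} → 0` — the
realised first-order entropy dissipation dominates `(1 − δ)` times the DV action of the non-junk cell-windows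
(mollifier moved from the observable to the measure; window-start instead of contact-time cell law; weights
`cw_a ↦ ½(cw_i + cw_j)`; co-moving floor shift; junk cell-windows bounded directly). Per-contact commutator input. -/
def IncrToMeasureOn (σ : ℝ) (a₀ θ₀ : T3 → ℝ) (u₀ : T3 → V3) (Φ : Flows σ) (ψ : ℕ → T3 → ℝ)
    (γc h δ t : ℝ) : Prop :=
  ∀ η : ℝ, 0 < η → Tendsto (fun N : ℕ => localGibbsLaw σ a₀ u₀ θ₀ N (Φ N)
    {z | realDiss σ N (Φ N) ψ h δ t z + η * ((N + 1 : ℕ) : ℝ) ^ ((1 : ℝ) / 3) <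
      (1 - δ) * dvActW σ N (Φ N) ψ γc h δ t z}) atTop (𝓝 0)

/-- (G2) THE DV INEQUALITY IN AGGREGATE: `∀ η > 0`, `P_N{dvActW + η (N+1)^{1/3} < crossEW − relEnt} → 0`.
Deterministic on the good set by `DVTransfer.dv_step` (per cell-window) once the three summands are integrable in
`x`; provable bookkeeping, kept as a typed input until discharged. -/
def DVAggregateOn (σ : ℝ) (a₀ θ₀ : T3 → ℝ) (u₀ : T3 → V3) (Φ : Flows σ) (ψ : ℕ → T3 → ℝ)
    (γc h δ t : ℝ) : Prop :=
  ∀ η : ℝ, 0 < η → Tendsto (fun N : ℕ => localGibbsLaw σ a₀ u₀ θ₀ N (Φ N)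
    {z | dvActW σ N (Φ N) ψ γc h δ t z + η * ((N + 1 : ℕ) : ℝ) ^ ((1 : ℝ) / 3) <
      crossEW σ N (Φ N) ψ γc h δ t z - relEnt σ N (Φ N) ψ γc h t z}) atTop (𝓝 0)

/-- (G3) CROSS-HELLINGER, one-sided: `∀ η > 0`, `P_N{crossEW + η (N+1)^{1/3} < chaosDissW} → 0` — the smeared
cross-Hellinger mass of the chaos reference dominates the window-start Hellinger dissipation charged to contacts
(KDE commutator `(f̂^{±1/2}) ∗ G_h` vs `(f ∗ G_h)^{±1/2}` and co-moving floor mismatch; exact for pairs from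
`f̂ ⊗ f̂ B/Z(f̂)` by file 2). Per-contact commutator input; stated one-sided with absolute slack because a relative
`O(δ)` defect cannot be absorbed into the hidden residue constant `c₀`. -/
def CrossHellingerOn (σ : ℝ) (a₀ θ₀ : T3 → ℝ) (u₀ : T3 → V3) (Φ : Flows σ) (ψ : ℕ → T3 → ℝ)
    (γc h δ t : ℝ) : Prop :=
  ∀ η : ℝ, 0 < η → Tendsto (fun N : ℕ => localGibbsLaw σ a₀ u₀ θ₀ N (Φ N)
    {z | crossEW σ N (Φ N) ψ γc h δ t z + η * ((N + 1 : ℕ) : ℝ) ^ ((1 : ℝ) / 3) <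
      chaosDissW σ N (Φ N) ψ γc h δ t z}) atTop (𝓝 0)

/-- (G4) WINDOW-START VS CONTACT-TIME chaotic dissipation: `∃ K₀ > 0 ∀ η > 0`,
`P_N{K₀ chaosDissW + η (N+1)^{1/3} < chaosDiss} → 0` — the Hellinger dissipation charged at contact time is
controlled by the one charged at the window start (`ν_N Δ_N → 0`: `o(1)` of a cell's atoms move per window). -/
def ChaosTimeOn (σ : ℝ) (a₀ θ₀ : T3 → ℝ) (u₀ : T3 → V3) (Φ : Flows σ) (ψ : ℕ → T3 → ℝ)
    (γc h δ t : ℝ) : Prop :=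
  ∃ K₀ : ℝ, 0 < K₀ ∧ ∀ η : ℝ, 0 < η → Tendsto (fun N : ℕ => localGibbsLaw σ a₀ u₀ θ₀ N (Φ N)
    {z | K₀ * chaosDissW σ N (Φ N) ψ γc h δ t z + η * ((N + 1 : ℕ) : ℝ) ^ ((1 : ℝ) / 3) <
      chaosDiss σ N (Φ N) ψ h δ t z}) atTop (𝓝 0)

/-! ## The corrected statement of S2 and its proof -/

/-- CORRECTED statement of S2 (`stub_dvTransfer`): same prefix as the registered stub, then for EVERY
`(h, δ) ∈ (0, 1)²` the four DV-chain inputs and the residue give the one-sided inequality. (The registered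
`∃ δ₀ h₀` form without G1–G4 is not derivable from `TailsOn` + `FewCollisionsOn`.) -/
def DVTransferStub' : Prop :=
  ∀ (a₀ θ₀ : T3 → ℝ) (u₀ : T3 → V3), NiceProfiles a₀ θ₀ u₀ → ∀ σ : ℝ, 0 < σ → σ < 2⁻¹ →
    ∀ (γc C' : ℝ) (ψ : ℕ → T3 → ℝ), 1 / 6 < γc → γc < 1 / 3 → AdmissibleKernel γc C' ψ →
      ∀ (Φ : Flows σ) (t : ℝ), 0 < t → TailsOn σ a₀ θ₀ u₀ Φ t → FewCollisionsOn σ a₀ θ₀ u₀ Φ t →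
        ∀ h δ : ℝ, 0 < h → h < 1 → 0 < δ → δ < 1 →
          IncrToMeasureOn σ a₀ θ₀ u₀ Φ ψ γc h δ t → DVAggregateOn σ a₀ θ₀ u₀ Φ ψ γc h δ t →
          CrossHellingerOn σ a₀ θ₀ u₀ Φ ψ γc h δ t → ChaosTimeOn σ a₀ θ₀ u₀ Φ ψ γc h δ t →
            EntropyChaosRelOn σ a₀ θ₀ u₀ Φ ψ γc h δ t → OneSidedOn σ a₀ θ₀ u₀ Φ ψ h δ t

/-- **The corrected S2 holds** (by `DVTransfer.oneSidedOn_of_dvChain` with `A = dvActW`, `E = crossEW`). -/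
theorem dvTransferStub'_holds : DVTransferStub' := by
  intro a₀ θ₀ u₀ _ σ _ _ γc C' ψ _ _ _ Φ t _ _ _ h δ _ _ _ hδ1 G1 G2 G3 G4 hR
  obtain ⟨K₀, hK₀, G4⟩ := G4
  exact DVTransfer.oneSidedOn_of_dvChain hδ1 (fun N z => dvActW σ N (Φ N) ψ γc h δ t z)
    (fun N z => crossEW σ N (Φ N) ψ γc h δ t z) hK₀ G1 G2 G3 G4 hR

/-! ## Registered anchor of this support file -/

/-- ANCHOR (registered helper stub `bhDVTransfer_inputs_anchor` of the crux item): the corrected S2 — for every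
`(h, δ) ∈ (0,1)²`, the DV-chain inputs G1–G4 and the residue `EntropyChaosRelOn` give `OneSidedOn`. -/
theorem bhDVTransfer_inputs_anchor : ∀ (a₀ θ₀ : T3 → ℝ) (u₀ : T3 → V3), NiceProfiles a₀ θ₀ u₀ → ∀ σ : ℝ, 0 < σ → σ < 2⁻¹ → ∀ (γc C' : ℝ) (ψ : ℕ → T3 → ℝ), 1 / 6 < γc → γc < 1 / 3 → AdmissibleKernel γc C' ψ → ∀ (Φ : Flows σ) (t : ℝ), 0 < t → TailsOn σ a₀ θ₀ u₀ Φ t → FewCollisionsOn σ a₀ θ₀ u₀ Φ t → ∀ h δ : ℝ, 0 < h → h < 1 → 0 < δ → δ < 1 → IncrToMeasureOn σ a₀ θ₀ u₀ Φ ψ γc h δ t → DVAggregateOn σ a₀ θ₀ u₀ Φ ψ γc h δ t → CrossHellingerOn σ a₀ θ₀ u₀ Φ ψ γc h δ t → ChaosTimeOn σ a₀ θ₀ u₀ Φ ψ γc h δ t → EntropyChaosRelOn σ a₀ θ₀ u₀ Φ ψ γc h δ t → OneSidedOn σ a₀ θ₀ u₀ Φ ψ h δ t :=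
  dvTransferStub'_holds

end

end Summit.AtomisticToContinuum.HydrodynamicLimit.Theorems.BlockHDissipation
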